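import Summits.QuantumFields.YangMills.Theorems.BalabanUVNodesN15KingModelPotentialComplexLetters
import Mathlib.Analysis.SpecificLimits.Basic

/-!
# N15 (NE2) King-model rung, PART 33 — [B9] THEOREM 3.4 IN KING'S MODEL, THE PACKAGE: the holomorphic continuum limit at complex coupling
# INHERITS the letters (locality, geometric approach WITH decay), and one citation point for the whole complex-coupling edition (parts 28–33)

Eleventh generation (g11) of the seat `pub-ymgap-dag-n15-d`, part 33 (on 32 `…PotentialComplexLetters` and 28d `…PotentialComplexLimit`).  Part 32 moved
the REAL-slice letters of the dressed covariances to the complex coupling disc by the two-constants theorem (cited BY NAME); part 28d built the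
holomorphic continuum limit `C^{(∞)}_z = lim_k C^{(k+1)}_{z·v}` there (Vitali) with the inverse identity.  Limits preserve `≤`, and a geometric two-spacing
rate sums to a geometric approach rate (`dist_le_of_le_geometric_of_tendsto`): so the LIMIT obeys the same letters.  On the King-admissible tori
`Π ℤ∕(2L^{e+1})` (odd `L ≥ 3`, `a, m² > 0`), in 10e's uniform window (`sup|v_N| ≤ w₀ ≤ w₁`, coherence defect `≤ ν₀s^k`):

* §1 `kingCovE_fullPert_decay` — the REAL-slice (4.34)(i) for the fully dressed covariances in 10e's window, `|C^{(k)}_v(x,y)| ≤ (4∕γ₀)·e^{−κ|x−y|}` at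
  every level (10e `dressedLeaves_fullPert` + part 5 `inv_entry_decay_of_leaves`; margin `γ₀∕4`);
* §2 ★★ `kingCovPotC_apply_decay_kingU` — (4.34)(i) AT COMPLEX COUPLING in the same window: `‖C^{(k)}_{z·v}(x,y)‖ ≤ (4∕γ₀)·e^{−(1−λ(r))κ|x−y|}` on the disc
  `‖z‖ < (r∕(1+r))·min(r_K∕w₀, 1)`, every `k ≥ 1`, `0 < r < 1` (part 32's method: `B13RealSliceEntryLetters.decay_of_realSlice` BY NAME);
* §4 ★★ `kingCovLimC_apply_decay` — THE LIMIT IS LOCAL: `‖C^{(∞)}_z(x,y)‖ ≤ (4∕γ₀)·e^{−(1−λ(r))κ|x−y|}` on the same disc (28d's pointwise convergence,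
  `le_of_tendsto'`); ★★ `kingCovPotC_sub_lim_decay` — THE GEOMETRIC APPROACH WITH DECAY AT COMPLEX COUPLING:
  `‖C^{(k+1)}_{z·v}(x,y) − C^{(∞)}_z(x,y)‖ ≤ C′·ϑ^{k+1}∕(1−ϑ)·e^{−(1−λ(r))(κ₂∕2)|x−y|}`, `ϑ = θ^{1−λ(r)} < 1`, `θ = L^{−1∕4}`, `C′ = C^{1−λ(r)}·M^{λ(r)}`
  (32 `kingCov_twoSpacing_complexRate_geometric` summed by `dist_le_of_le_geometric_of_tendsto`);
* §3 ★★★ `kingModel_complexCoupling_package` — ONE CITATION POINT for [B9] Thm 3.4 in King's A = 0 model: on the disc, for every tower of the window,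
  (a) every `C^{(k)}_{z·v}(x,y)` and `C^{(∞)}_z(x,y)` is holomorphic in `z` (28b ∕ 28d), (b) `‖·‖ ≤ 2∕γ₀` (28b ∕ 28d), (c) locality (§2, and its limit), (d) the two-spacing
  η-rate with decay and one exponent (32), (e) the geometric approach to the limit with decay (32 summed along 28d's sequence), (f) `C^{(∞)}_z = (Δ^{(∞)}_{z·v} + aL⁻²Q*Q)⁻¹` (28d).

References (method): two-constants theorem [Ransford1995, Thm. 4.3.7] via the tree's `TwoConstantsDisc` ∕ `B13RealSliceEntryLetters` (BY NAME); Vitali (28c);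
template [B9] Thm 3.4 p.400; King (4.32)–(4.34), Lemma 4.5 (4.38) p.674, §4 pp.675–676.

HONEST SCOPE.  King's A = 0 SCALAR model; REAL potential towers × ONE complex coupling (a complex mass insertion — NOT a gauge field, NOT Bałaban's
`U′U`); losses = those of the two-constants theorem (radius `r∕(1+r)`, exponent `1 − λ(r)`); nothing about Bałaban's `C^{(k)}(Λ;U)`; NOT a node discharge;
count-neutral.  No `sorry`, standard axioms, default heartbeats.
-/

noncomputable section

open scoped BigOperators Matrix
open Filter Topology Metric Finset Complex

namespace Summit.QuantumFields.YangMills.BalabanUVNodes.N15.KingModel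

open Literature.MathematicalPhysics.QuantumFieldTheory.Balaban1983to89 hiding blockOf
open Literature.MathematicalPhysics.QuantumFieldTheory.Balaban1983to89.B5Prop11Plancherel (Tor fine)
open Literature.MathematicalPhysics.QuantumFieldTheory.Balaban1983to89.B13RealSliceEntryLetters (lam lam_nonneg lam_lt_one lam_le
  decay_of_realSlice realStructureComplex)
open Literature.MathematicalPhysics.QuantumFieldTheory.King1986 (aK aK_pos aK_le)
open Literature.MathematicalPhysics.QuantumFieldTheory.King1986.Torus (gam0L gam0L_pos tdistT tdistT_isPseudoDist kapCT kapCT_pos_le)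
open Summit.QuantumFields.BalabanUV.T4Continuum.NE2KingTransplant (IsPseudoMetric UniformCoercive UniformCTBound)
open Summit.QuantumFields.YangMills.BalabanUVNodes.N15KingModelRung.Curved (underPtN)

variable {d : ℕ}

section KingU

variable (L : ℕ) [NeZero L]

/-! ## §1 The real-slice locality of the fully dressed covariances in 10e's uniform window -/

/-- **(4.34)(i) FOR THE FULLY DRESSED COVARIANCES IN 10e's WINDOW (real slice).**  For odd `L ≥ 3`, `a, m² > 0` there are `κ, w₁ > 0` such that for every
volume exponent `e`, every potential tower `v` with `sup|v_N| ≤ w₀ ≤ w₁`, coherence defect `≤ ν₀s^k` (`0 ≤ ν₀ ≤ w₁`, `0 ≤ s ≤ L^{−1∕2}`), every level `k` and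
all sites: `|C^{(k)}_v(x,y)| ≤ (4∕γ₀)·e^{−κ|x−y|_T}` (10e's leaves (H1)–(H2) with margin `γ₀ − 2w₀c₁V − ρ − ρ_B ≥ γ₀∕4`, fed to part 5's
`inv_entry_decay_of_leaves`). [cite: King1986, (4.33)–(4.34) p.674 (A = 0 template)] -/
theorem kingCovE_fullPert_decay (hLodd : Odd L) (hL : 2 ≤ L) {a m2 : ℝ} (ha : 0 < a) (hm : 0 < m2) :
    ∃ κ w₁ : ℝ, 0 < κ ∧ 0 < w₁ ∧
      ∀ (e : ℕ) (v : ∀ N : ℕ, Tor (fine N (kingU d L e)) → ℝ) (w₀ ν₀ s : ℝ),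
      0 ≤ ν₀ → ν₀ ≤ w₁ → 0 ≤ s → s ≤ (L : ℝ) ^ (-(1 / 2 : ℝ)) →
      (∀ (N : ℕ) (x : Tor (fine N (kingU d L e))), |v N x| ≤ w₀) → w₀ ≤ w₁ →
      (∀ (k : ℕ), 1 ≤ k → ∀ x' : Tor (fine (L ^ 1 * L ^ k) (kingU d L e)),
          |v (L ^ 1 * L ^ k) x' - v (L ^ k) (underPtN L k 1 (kingU d L e) x')| ≤ ν₀ * s ^ k) →
      ∀ (k : ℕ) (x y : Tor (kingU d L e)),
        |kingCovE a m2 L (kingM d L e) (fullPert a m2 L (kingM d L e) v) k x y|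
          ≤ 4 / gam0L (d + 1) a L * Real.exp (-(κ * tdistT (kingU d L e) x y)) := by
  obtain ⟨κ, c₁, V, w₁, hκ, hc₁, hV, hw₁, hgap8, HD⟩ := dressedLeaves_fullPert (d := d) L hLodd hL ha hm
  refine ⟨κ, w₁, hκ, hw₁, ?_⟩
  intro e v w₀ ν₀ s hν0 hν1 hs0 hs1 hsize hw hcoh k x y
  have hγ := gam0L_pos (d := d + 1) ha hL
  have hρ := kingRho_add_le (dd := d + 1) ha hL
  set γ₀ := gam0L (d + 1) a L with hγ₀
  have hw0 : 0 ≤ w₀ := (abs_nonneg _).trans (hsize 1 (fun _ => 0))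
  obtain ⟨g1, g2, -, -, -⟩ := HD e v w₀ ν₀ s hν0 hν1 hs0 hs1 hsize hw hcoh
  have hwV : w₀ * c₁ * V ≤ γ₀ / 8 := (mul_le_mul_of_nonneg_right (mul_le_mul_of_nonneg_right hw hc₁.le) hV.le).trans hgap8
  have hgap : kingRho (d + 1) a L + w₀ * c₁ * V + kingRhoB (d + 1) a L < γ₀ - w₀ * c₁ * V := by linarith
  have h := inv_entry_decay_of_leaves (isPseudoMetric_tdistT (kingU d L e)) hgap hκ.le g1 g2 k x y
  have hmar : γ₀ / 4 ≤ γ₀ - w₀ * c₁ * V - (kingRho (d + 1) a L + w₀ * c₁ * V + kingRhoB (d + 1) a L) := by linarith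
  have hinvle : (γ₀ - w₀ * c₁ * V - (kingRho (d + 1) a L + w₀ * c₁ * V + kingRhoB (d + 1) a L))⁻¹ ≤ 4 / γ₀ := by
    have h2 : (γ₀ - w₀ * c₁ * V - (kingRho (d + 1) a L + w₀ * c₁ * V + kingRhoB (d + 1) a L))⁻¹ ≤ (γ₀ / 4)⁻¹ :=
      inv_anti₀ (by positivity) hmar
    rwa [inv_div] at h2
  calc |kingCovE a m2 L (kingM d L e) (fullPert a m2 L (kingM d L e) v) k x y|
      = |((kingTower a m2 L (kingM d L e) + fullPert a m2 L (kingM d L e) v) k + kingBlock a L (kingM d L e))⁻¹ x y| := rfl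
    _ ≤ _ := h
    _ ≤ 4 / γ₀ * Real.exp (-(κ * tdistT (kingU d L e) x y)) := mul_le_mul_of_nonneg_right hinvle (Real.exp_pos _).le

/-! ## §2 Locality at complex coupling in the same window -/

/-- ★★ **(4.34)(i) AT COMPLEX COUPLING, 10e's WINDOW.**  For odd `L ≥ 3`, `a, m² > 0` there are `κ, w₁ > 0` such that for every volume exponent, every
potential tower `v` with `sup|v_N| ≤ w₀ ≤ w₁`, `w₀ > 0`, coherence defect `≤ ν₀s^k`, every `k ≥ 1`, every `0 < r < 1`, every complex coupling with
`‖z‖ < (r∕(1+r))·min(r_K∕w₀, 1)` and all sites: `‖C^{(k)}_{z·v}(x,y)‖ ≤ (4∕γ₀)·e^{−(1−λ(r))κ|x−y|_T}` (§1 on the diameter, 28b's `2∕γ₀` on the disc,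
`decay_of_realSlice` BY NAME). [cite: King1986, (4.34) p.674 (A = 0 template); Balaban1985BackgroundPropagators, Thm 3.4 p.400; Ransford1995, Thm. 4.3.7] -/
theorem kingCovPotC_apply_decay_kingU (hLodd : Odd L) (hL : 2 ≤ L) {a m2 : ℝ} (ha : 0 < a) (hm : 0 < m2) :
    ∃ κ w₁ : ℝ, 0 < κ ∧ 0 < w₁ ∧
      ∀ (e : ℕ) (v : ∀ N : ℕ, Tor (fine N (kingU d L e)) → ℝ) (w₀ ν₀ s : ℝ),
      0 ≤ ν₀ → ν₀ ≤ w₁ → 0 ≤ s → s ≤ (L : ℝ) ^ (-(1 / 2 : ℝ)) →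
      0 < w₀ → (∀ (N : ℕ) (x : Tor (fine N (kingU d L e))), |v N x| ≤ w₀) → w₀ ≤ w₁ →
      (∀ (k : ℕ), 1 ≤ k → ∀ x' : Tor (fine (L ^ 1 * L ^ k) (kingU d L e)),
          |v (L ^ 1 * L ^ k) x' - v (L ^ k) (underPtN L k 1 (kingU d L e) x')| ≤ ν₀ * s ^ k) →
      ∀ (k : ℕ), 1 ≤ k → ∀ (r : ℝ), 0 < r → r < 1 → ∀ z : ℂ, ‖z‖ < r / (1 + r) * min (cplxWindow d a m2 L / w₀) 1 →
      ∀ x y : Tor (kingU d L e),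
        ‖kingCovPotC d a m2 L (kingM d L e) k z (v (L ^ k)) x y‖
          ≤ 4 / gam0L (d + 1) a L * Real.exp (-((1 - lam r) * κ * tdistT (kingU d L e) x y)) := by
  obtain ⟨κ, w₁, hκ, hw₁, H⟩ := kingCovE_fullPert_decay (d := d) L hLodd hL ha hm
  refine ⟨κ, w₁, hκ, hw₁, ?_⟩
  intro e v w₀ ν₀ s hν₀ hν₁ hs0 hs1 hw₀ hv hw₁' hcoh k hk r hr0 hr1 z hz x y
  have hγ := gam0L_pos (d := d + 1) ha hL
  set R₁ : ℝ := min (cplxWindow d a m2 L / w₀) 1 with hR₁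
  set B : ℝ := 4 / gam0L (d + 1) a L with hB
  have hB0 : 0 ≤ B := by positivity
  set K : ℂ → Matrix (Tor (kingU d L e)) (Tor (kingU d L e)) ℂ := fun u => kingCovPotC d a m2 L (kingM d L e) k u (v (L ^ k)) with hK
  have hKd : ∀ i j, DifferentiableOn ℂ (fun u => K u i j) (ball (0 : ℂ) R₁) := fun i j =>
    differentiableOn_kingCovPotC_ball (d := d) ha hm hL hk hw₀ (hv _) i j
  have hKM : ∀ u ∈ ball (0 : ℂ) R₁, ∀ i j, ‖K u i j‖ ≤ B := by
    intro u hu i j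
    have h := kingCovPotC_apply_norm_le (M := kingM d L e) ha hm hL hk hw₀.le (hv _)
      (norm_mul_le_cplxWindow_of_mem_ball (d := d) (a := a) (m2 := m2) (L := L) hw₀ hu) i j
    refine h.trans ?_
    rw [hB, div_le_div_iff_of_pos_right hγ]
    norm_num
  have hKB : ∀ u ∈ realStructureComplex.Ereal, ‖u‖ < R₁ → ∀ i j,
      ‖K u i j‖ ≤ B * Real.exp (-(κ * tdistT (kingU d L e) i j)) := by
    intro u hu huR i j
    obtain ⟨t, rfl, ht1⟩ := exists_real_of_mem_Ereal hu (min_le_right _ _) huR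
    have hvt : ∀ (N : ℕ) (x : Tor (fine N (kingU d L e))), |(t • v) N x| ≤ |t| * w₀ := by
      intro N x'
      show |t * v N x'| ≤ |t| * w₀
      rw [abs_mul]
      exact mul_le_mul_of_nonneg_left (hv N x') (abs_nonneg t)
    have hcoht : ∀ (k : ℕ), 1 ≤ k → ∀ x' : Tor (fine (L ^ 1 * L ^ k) (kingU d L e)),
        |(t • v) (L ^ 1 * L ^ k) x' - (t • v) (L ^ k) (underPtN L k 1 (kingU d L e) x')| ≤ (|t| * ν₀) * s ^ k := by
      intro k hk x'
      show |t * v (L ^ 1 * L ^ k) x' - t * v (L ^ k) (underPtN L k 1 (kingU d L e) x')| ≤ (|t| * ν₀) * s ^ k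
      rw [← mul_sub, abs_mul, mul_assoc]
      exact mul_le_mul_of_nonneg_left (hcoh k hk x') (abs_nonneg t)
    have htw : |t| * w₀ ≤ w₁ := by nlinarith [abs_nonneg t]
    have htν : |t| * ν₀ ≤ w₁ := by nlinarith [abs_nonneg t]
    have hdec := H e (t • v) (|t| * w₀) (|t| * ν₀) s (by positivity) htν hs0 hs1 hvt htw hcoht k i j
    show ‖kingCovPotC d a m2 L (kingM d L e) k (t : ℂ) (v (L ^ k)) i j‖ ≤ _
    rw [kingCovPotC_real_eq_kingCovE v hk t i j, Complex.norm_real, Real.norm_eq_abs]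
    exact hdec
  have hdist : ∀ i j : Tor (kingU d L e), 0 ≤ tdistT (kingU d L e) i j := (tdistT_isPseudoDist (kingU d L e)).nonneg
  have key := decay_of_realSlice realStructureComplex hKd hKM hKB hB0 le_rfl hκ.le hdist hr0 hr1 z (by rwa [mem_ball_zero_iff]) x y
  refine key.trans (le_of_eq ?_)
  have hsum : (1 - lam r) + lam r = 1 := by ring
  rw [← Real.rpow_add' hB0 (by rw [hsum]; exact one_ne_zero), hsum, Real.rpow_one]

/-! ## §3 One citation point: [B9] Theorem 3.4 in King's model — two geometric lemmas, then the package -/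

omit [NeZero L] in
/-- The radius `(r∕(1+r))·min(r_K∕w₀, 1)` is at most `min(r_K∕w₀, 1)` and at most `r_K∕w₀`. [folklore] -/
theorem disc_radius_le {a m2 w₀ r : ℝ} (hr0 : 0 < r) (hw₀ : 0 < w₀) (hwin : 0 < cplxWindow d a m2 L) :
    r / (1 + r) * min (cplxWindow d a m2 L / w₀) 1 ≤ min (cplxWindow d a m2 L / w₀) 1 ∧
      r / (1 + r) * min (cplxWindow d a m2 L / w₀) 1 ≤ cplxWindow d a m2 L / w₀ := by
  have h1 : r / (1 + r) ≤ 1 := (div_le_one (by linarith)).2 (by linarith)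
  have h2 : 0 ≤ min (cplxWindow d a m2 L / w₀) 1 := le_min (div_pos hwin hw₀).le zero_le_one
  have h3 : r / (1 + r) * min (cplxWindow d a m2 L / w₀) 1 ≤ min (cplxWindow d a m2 L / w₀) 1 := by
    calc r / (1 + r) * min (cplxWindow d a m2 L / w₀) 1 ≤ 1 * min (cplxWindow d a m2 L / w₀) 1 := mul_le_mul_of_nonneg_right h1 h2
      _ = _ := one_mul _
  exact ⟨h3, h3.trans (min_le_left _ _)⟩

omit [NeZero L] in
/-- The disc `‖z‖ < (r∕(1+r))·min(r_K∕w₀, 1)` lies in 28d's ball `‖z‖ < r_K∕w₀`. [folklore] -/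
theorem mem_ball_cplxWindow_of_lt {a m2 w₀ r : ℝ} (hr0 : 0 < r) (hw₀ : 0 < w₀) (hwin : 0 < cplxWindow d a m2 L) {z : ℂ}
    (hz : ‖z‖ < r / (1 + r) * min (cplxWindow d a m2 L / w₀) 1) : z ∈ ball (0 : ℂ) (cplxWindow d a m2 L / w₀) :=
  mem_ball_zero_iff.2 (lt_of_lt_of_le hz (disc_radius_le (d := d) L hr0 hw₀ hwin).2)

/-- ★★★ **[B9] THEOREM 3.4 IN KING'S A = 0 MODEL — THE COMPLEX-COUPLING EDITION IN ONE THEOREM.**  For odd `L ≥ 3`, `a, m² > 0` there are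
`κ₁, κ₂, w₁, C > 0` such that for every volume exponent `e`, every potential tower `v` with `sup|v_N| ≤ w₀ ≤ w₁`, `w₀ > 0`, coherence defect `≤ ν₀s^k`
(`0 ≤ ν₀ ≤ w₁`, `0 ≤ s ≤ L^{−1∕2}`), every `0 < r < 1` and every complex coupling `z` of the disc `‖z‖ < (r∕(1+r))·min(r_K∕w₀, 1)`, writing
`λ = λ(r)`, `θ = L^{−1∕4}`, `ϑ = θ^{1−λ}`, `M = max(C, 4∕γ₀)`:
(a) HOLOMORPHY — every entry `ζ ↦ C^{(k)}_{ζ·v}(x,y)` (`k ≥ 1`) and `ζ ↦ C^{(∞)}_ζ(x,y)` is ℂ-differentiable on the disc;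
(b) BOUNDS — `‖C^{(k)}_{z·v}(x,y)‖ ≤ 2∕γ₀` (`k ≥ 1`) and `‖C^{(∞)}_z(x,y)‖ ≤ 2∕γ₀`;
(c) LOCALITY — `‖C^{(k)}_{z·v}(x,y)‖ ≤ (4∕γ₀)e^{−(1−λ)κ₁|x−y|}` (`k ≥ 1`) and `‖C^{(∞)}_z(x,y)‖ ≤ (4∕γ₀)e^{−(1−λ)κ₁|x−y|}`;
(d) THE η-RATE WITH DECAY — `‖C^{(k+1)}_{z·v}(x,y) − C^{(k)}_{z·v}(x,y)‖ ≤ C^{1−λ}M^{λ}ϑ^k·e^{−(1−λ)(κ₂∕2)|x−y|}` (`k ≥ 1`);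
(e) THE CONTINUUM LIMIT WITH DECAY — `‖C^{(k+1)}_{z·v}(x,y) − C^{(∞)}_z(x,y)‖ ≤ C^{1−λ}M^{λ}e^{−(1−λ)(κ₂∕2)|x−y|}·ϑ^{k+1}∕(1−ϑ)` (all `k`);
(f) THE INVERSE IDENTITY — `C^{(∞)}_z = (Δ^{(∞)}_{z·v} + aL⁻²Q*Q)⁻¹`.
(28b, 28d, 32, §2–§3.) [cite: Balaban1985BackgroundPropagators, Thm 3.4 p.400, (3.64)–(3.65) p.402 (template); King1986, (4.32)–(4.34), Lemma 4.5 (4.38) p.674, §4 pp.675–676 (A = 0); Ransford1995, Thm. 4.3.7] -/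
theorem kingModel_complexCoupling_package (hLodd : Odd L) (hL : 2 ≤ L) {a m2 : ℝ} (ha : 0 < a) (hm : 0 < m2) :
    ∃ κ₁ κ₂ w₁ C : ℝ, 0 < κ₁ ∧ 0 < κ₂ ∧ 0 < w₁ ∧ 0 < C ∧
      ∀ (e : ℕ) (v : ∀ N : ℕ, Tor (fine N (kingU d L e)) → ℝ) (w₀ ν₀ s : ℝ),
      0 ≤ ν₀ → ν₀ ≤ w₁ → 0 ≤ s → s ≤ (L : ℝ) ^ (-(1 / 2 : ℝ)) →
      0 < w₀ → (∀ (N : ℕ) (x : Tor (fine N (kingU d L e))), |v N x| ≤ w₀) → w₀ ≤ w₁ →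
      (∀ (k : ℕ), 1 ≤ k → ∀ x' : Tor (fine (L ^ 1 * L ^ k) (kingU d L e)),
          |v (L ^ 1 * L ^ k) x' - v (L ^ k) (underPtN L k 1 (kingU d L e) x')| ≤ ν₀ * s ^ k) →
      ∀ (r : ℝ), 0 < r → r < 1 → ∀ z : ℂ, ‖z‖ < r / (1 + r) * min (cplxWindow d a m2 L / w₀) 1 →
      ∀ x y : Tor (kingU d L e),
        (∀ k, 1 ≤ k → DifferentiableOn ℂ (fun ζ => kingCovPotC d a m2 L (kingM d L e) k ζ (v (L ^ k)) x y)
            (ball 0 (r / (1 + r) * min (cplxWindow d a m2 L / w₀) 1))) ∧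
        DifferentiableOn ℂ (fun ζ => kingCovLimC a m2 L (kingM d L e) v ζ x y) (ball 0 (r / (1 + r) * min (cplxWindow d a m2 L / w₀) 1)) ∧
        (∀ k, 1 ≤ k → ‖kingCovPotC d a m2 L (kingM d L e) k z (v (L ^ k)) x y‖ ≤ 2 / gam0L (d + 1) a L) ∧
        ‖kingCovLimC a m2 L (kingM d L e) v z x y‖ ≤ 2 / gam0L (d + 1) a L ∧
        (∀ k, 1 ≤ k → ‖kingCovPotC d a m2 L (kingM d L e) k z (v (L ^ k)) x y‖
            ≤ 4 / gam0L (d + 1) a L * Real.exp (-((1 - lam r) * κ₁ * tdistT (kingU d L e) x y))) ∧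
        ‖kingCovLimC a m2 L (kingM d L e) v z x y‖ ≤ 4 / gam0L (d + 1) a L * Real.exp (-((1 - lam r) * κ₁ * tdistT (kingU d L e) x y)) ∧
        (∀ k, 1 ≤ k →
          ‖kingCovPotC d a m2 L (kingM d L e) (k + 1) z (v (L ^ (k + 1))) x y - kingCovPotC d a m2 L (kingM d L e) k z (v (L ^ k)) x y‖
            ≤ C ^ (1 - lam r) * (max C (4 / gam0L (d + 1) a L)) ^ lam r * ((((L : ℝ) ^ (-(1 / 4 : ℝ))) ^ (1 - lam r)) ^ k)
                * Real.exp (-((1 - lam r) * (κ₂ / 2) * tdistT (kingU d L e) x y))) ∧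
        (∀ k : ℕ,
          ‖kingCovPotC d a m2 L (kingM d L e) (k + 1) z (v (L ^ (k + 1))) x y - kingCovLimC a m2 L (kingM d L e) v z x y‖
            ≤ C ^ (1 - lam r) * (max C (4 / gam0L (d + 1) a L)) ^ lam r * Real.exp (-((1 - lam r) * (κ₂ / 2) * tdistT (kingU d L e) x y))
                * ((((L : ℝ) ^ (-(1 / 4 : ℝ))) ^ (1 - lam r)) ^ (k + 1)) / (1 - ((L : ℝ) ^ (-(1 / 4 : ℝ))) ^ (1 - lam r))) ∧
        kingCovLimC a m2 L (kingM d L e) v z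
          = (kingLevelLimC a m2 L (kingM d L e) v z + (kingBlock a L (kingM d L e)).map Complex.ofReal)⁻¹ := by
  obtain ⟨κ₁, w₁, hκ₁, hw₁, H1⟩ := kingCovPotC_apply_decay_kingU (d := d) L hLodd hL ha hm
  obtain ⟨κ₂, w₃, C, hκ₂, hw₃, hC, H3⟩ := kingCov_twoSpacing_complexRate_geometric (d := d) L hLodd hL ha hm
  obtain ⟨w₅, hw₅, H5⟩ := king_continuumLimit_operator_holomorphic (d := d) L hLodd hL ha hm
  refine ⟨κ₁, κ₂, min w₁ (min w₃ w₅), C, hκ₁, hκ₂, lt_min hw₁ (lt_min hw₃ hw₅), hC, ?_⟩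
  intro e v w₀ ν₀ s hν₀ hν₁ hs0 hs1 hw₀ hv hw₁v hcoh r hr0 hr1 z hz x y
  have hν1 : ν₀ ≤ w₁ := hν₁.trans (min_le_left _ _)
  have hν3 : ν₀ ≤ w₃ := hν₁.trans ((min_le_right _ _).trans (min_le_left _ _))
  have hν5 : ν₀ ≤ w₅ := hν₁.trans ((min_le_right _ _).trans (min_le_right _ _))
  have hw1 : w₀ ≤ w₁ := hw₁v.trans (min_le_left _ _)
  have hw3 : w₀ ≤ w₃ := hw₁v.trans ((min_le_right _ _).trans (min_le_left _ _))
  have hw5 : w₀ ≤ w₅ := hw₁v.trans ((min_le_right _ _).trans (min_le_right _ _))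
  have hγ := gam0L_pos (d := d + 1) ha hL
  have hwin := cplxWindow_pos (d := d) (L := L) ha hm hL
  obtain ⟨hrad1, hrad2⟩ := disc_radius_le (d := d) (a := a) (m2 := m2) L hr0 hw₀ hwin
  have hzR := mem_ball_cplxWindow_of_lt (d := d) L hr0 hw₀ hwin hz
  have hz1 : z ∈ ball (0 : ℂ) (min (cplxWindow d a m2 L / w₀) 1) := mem_ball_zero_iff.2 (lt_of_lt_of_le hz hrad1)
  have hzw := norm_mul_le_cplxWindow_of_mem_ball (d := d) (a := a) (m2 := m2) (L := L) hw₀ hz1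
  obtain ⟨-, hcov, -, hinv, -, hbd⟩ := H5 e v w₀ ν₀ s hν₀ hν5 hs0 hs1 hw₀ hv hw5 hcoh z hzR
  have hlim := (hcov x y).2
  -- (c) at every level, and (d) the geometric rate, with the common witnesses
  have hc : ∀ k, 1 ≤ k → ‖kingCovPotC d a m2 L (kingM d L e) k z (v (L ^ k)) x y‖
      ≤ 4 / gam0L (d + 1) a L * Real.exp (-((1 - lam r) * κ₁ * tdistT (kingU d L e) x y)) := fun k hk =>
    H1 e v w₀ ν₀ s hν₀ hν1 hs0 hs1 hw₀ hv hw1 hcoh k hk r hr0 hr1 z hz x y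
  have hd : ∀ k, 1 ≤ k →
      ‖kingCovPotC d a m2 L (kingM d L e) (k + 1) z (v (L ^ (k + 1))) x y - kingCovPotC d a m2 L (kingM d L e) k z (v (L ^ k)) x y‖
        ≤ C ^ (1 - lam r) * (max C (4 / gam0L (d + 1) a L)) ^ lam r * ((((L : ℝ) ^ (-(1 / 4 : ℝ))) ^ (1 - lam r)) ^ k)
            * Real.exp (-((1 - lam r) * (κ₂ / 2) * tdistT (kingU d L e) x y)) := fun k hk =>
    H3 e v w₀ ν₀ s hν₀ hν3 hs0 hs1 hw₀ hv hw3 hcoh x y k hk r hr0 hr1 z hz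
  -- (e) the geometric approach: sum (d) along 28d's convergent sequence
  set θ : ℝ := (L : ℝ) ^ (-(1 / 4 : ℝ)) with hθ
  set ϑ : ℝ := θ ^ (1 - lam r) with hϑ
  set A : ℝ := C ^ (1 - lam r) * (max C (4 / gam0L (d + 1) a L)) ^ lam r * Real.exp (-((1 - lam r) * (κ₂ / 2) * tdistT (kingU d L e) x y))
    with hA
  have hθ0 : 0 ≤ θ := Real.rpow_nonneg (Nat.cast_nonneg _) _
  have hθ1 : θ < 1 := by
    have hL1 : (1 : ℝ) < L := by exact_mod_cast (by omega : 1 < L)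
    exact Real.rpow_lt_one_of_one_lt_of_neg hL1 (by norm_num)
  have hlam1 := lam_lt_one r
  have hϑ1 : ϑ < 1 := Real.rpow_lt_one hθ0 hθ1 (by linarith)
  set f : ℕ → ℂ := fun n => kingCovPotC d a m2 L (kingM d L e) (n + 1) z (v (L ^ (n + 1))) x y with hf
  have hstep : ∀ n, dist (f n) (f (n + 1)) ≤ (A * ϑ) * ϑ ^ n := by
    intro n
    have h := hd (n + 1) (Nat.succ_le_succ (Nat.zero_le n))
    rw [dist_eq_norm, ← norm_neg, neg_sub]
    calc ‖f (n + 1) - f n‖ = ‖kingCovPotC d a m2 L (kingM d L e) (n + 1 + 1) z (v (L ^ (n + 1 + 1))) x y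
          - kingCovPotC d a m2 L (kingM d L e) (n + 1) z (v (L ^ (n + 1))) x y‖ := rfl
      _ ≤ C ^ (1 - lam r) * (max C (4 / gam0L (d + 1) a L)) ^ lam r * (ϑ ^ (n + 1))
            * Real.exp (-((1 - lam r) * (κ₂ / 2) * tdistT (kingU d L e) x y)) := h
      _ = (A * ϑ) * ϑ ^ n := by rw [hA, pow_succ]; ring
  have he : ∀ k : ℕ, ‖kingCovPotC d a m2 L (kingM d L e) (k + 1) z (v (L ^ (k + 1))) x y - kingCovLimC a m2 L (kingM d L e) v z x y‖
      ≤ A * ϑ ^ (k + 1) / (1 - ϑ) := by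
    intro k
    have key := dist_le_of_le_geometric_of_tendsto ϑ (A * ϑ) hϑ1 hstep hlim k
    rw [dist_eq_norm] at key
    calc ‖kingCovPotC d a m2 L (kingM d L e) (k + 1) z (v (L ^ (k + 1))) x y - kingCovLimC a m2 L (kingM d L e) v z x y‖
        = ‖f k - kingCovLimC a m2 L (kingM d L e) v z x y‖ := rfl
      _ ≤ A * ϑ * ϑ ^ k / (1 - ϑ) := key
      _ = A * ϑ ^ (k + 1) / (1 - ϑ) := by rw [pow_succ]; ring
  refine ⟨fun k hk => (differentiableOn_kingCovPotC_ball (d := d) ha hm hL hk hw₀ (hv _) x y).mono (ball_subset_ball hrad1),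
    (hcov x y).1.mono (ball_subset_ball hrad2),
    fun k hk => kingCovPotC_apply_norm_le ha hm hL hk hw₀.le (hv _) hzw x y, hbd x y, hc,
    le_of_tendsto' hlim.norm fun n => hc (n + 1) (Nat.succ_le_succ (Nat.zero_le n)), hd, he, hinv⟩


/-! ## §4 The two limit letters as stand-alone corollaries -/

/-- ★★ **THE LIMIT COVARIANCE IS EXPONENTIALLY LOCAL AT COMPLEX COUPLING.**  For odd `L ≥ 3`, `a, m² > 0` there are `κ, w₁ > 0` such that for every
volume exponent, every potential tower of the window (`sup|v_N| ≤ w₀ ≤ w₁`, `w₀ > 0`, coherence defect `≤ ν₀s^k`), every `0 < r < 1`, every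
complex coupling with `‖z‖ < (r∕(1+r))·min(r_K∕w₀, 1)` and all sites: `‖C^{(∞)}_z(x,y)‖ ≤ (4∕γ₀)·e^{−(1−λ(r))κ|x−y|_T}` (§2 at every level `k + 1`,
28d's pointwise convergence `C^{(k+1)}_{z·v}(x,y) → C^{(∞)}_z(x,y)`, `le_of_tendsto'`; projection (c) of the package).
[cite: King1986, (4.34) p.674 and §4 pp.675–676 (A = 0 template); Balaban1985BackgroundPropagators, Thm 3.4 p.400] -/
theorem kingCovLimC_apply_decay (hLodd : Odd L) (hL : 2 ≤ L) {a m2 : ℝ} (ha : 0 < a) (hm : 0 < m2) :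
    ∃ κ w₁ : ℝ, 0 < κ ∧ 0 < w₁ ∧
      ∀ (e : ℕ) (v : ∀ N : ℕ, Tor (fine N (kingU d L e)) → ℝ) (w₀ ν₀ s : ℝ),
      0 ≤ ν₀ → ν₀ ≤ w₁ → 0 ≤ s → s ≤ (L : ℝ) ^ (-(1 / 2 : ℝ)) →
      0 < w₀ → (∀ (N : ℕ) (x : Tor (fine N (kingU d L e))), |v N x| ≤ w₀) → w₀ ≤ w₁ →
      (∀ (k : ℕ), 1 ≤ k → ∀ x' : Tor (fine (L ^ 1 * L ^ k) (kingU d L e)),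
          |v (L ^ 1 * L ^ k) x' - v (L ^ k) (underPtN L k 1 (kingU d L e) x')| ≤ ν₀ * s ^ k) →
      ∀ (r : ℝ), 0 < r → r < 1 → ∀ z : ℂ, ‖z‖ < r / (1 + r) * min (cplxWindow d a m2 L / w₀) 1 →
      ∀ x y : Tor (kingU d L e),
        ‖kingCovLimC a m2 L (kingM d L e) v z x y‖ ≤ 4 / gam0L (d + 1) a L * Real.exp (-((1 - lam r) * κ * tdistT (kingU d L e) x y)) := by
  obtain ⟨κ₁, κ₂, w₁, C, hκ₁, -, hw₁, -, H⟩ := kingModel_complexCoupling_package (d := d) L hLodd hL ha hm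
  refine ⟨κ₁, w₁, hκ₁, hw₁, ?_⟩
  intro e v w₀ ν₀ s hν₀ hν₁ hs0 hs1 hw₀ hv hw₁v hcoh r hr0 hr1 z hz x y
  exact (H e v w₀ ν₀ s hν₀ hν₁ hs0 hs1 hw₀ hv hw₁v hcoh r hr0 hr1 z hz x y).2.2.2.2.2.1

/-- ★★ **THE GEOMETRIC APPROACH TO THE LIMIT, WITH DECAY, AT COMPLEX COUPLING.**  For odd `L ≥ 3`, `a, m² > 0` there are `κ, w₁, C > 0` such that for
every volume exponent, every potential tower of the window, every `0 < r < 1`, every complex coupling with `‖z‖ < (r∕(1+r))·min(r_K∕w₀, 1)`, all sites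
and every `k`: with `θ = L^{−1∕4}`, `ϑ := θ^{1−λ(r)}`, `M := max(C, 4∕γ₀)`,
`‖C^{(k+1)}_{z·v}(x,y) − C^{(∞)}_z(x,y)‖ ≤ C^{1−λ(r)}·M^{λ(r)}·e^{−(1−λ(r))(κ∕2)|x−y|_T}·ϑ^{k+1}∕(1−ϑ)` — part 32's geometric two-spacing rate summed along
28d's convergent sequence (`dist_le_of_le_geometric_of_tendsto`; projection (e) of the package).
[cite: King1986, Lemma 4.5 (4.38) p.674, §4 pp.675–676 (A = 0 template); Ransford1995, Thm. 4.3.7] -/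
theorem kingCovPotC_sub_lim_decay (hLodd : Odd L) (hL : 2 ≤ L) {a m2 : ℝ} (ha : 0 < a) (hm : 0 < m2) :
    ∃ κ w₁ C : ℝ, 0 < κ ∧ 0 < w₁ ∧ 0 < C ∧
      ∀ (e : ℕ) (v : ∀ N : ℕ, Tor (fine N (kingU d L e)) → ℝ) (w₀ ν₀ s : ℝ),
      0 ≤ ν₀ → ν₀ ≤ w₁ → 0 ≤ s → s ≤ (L : ℝ) ^ (-(1 / 2 : ℝ)) →
      0 < w₀ → (∀ (N : ℕ) (x : Tor (fine N (kingU d L e))), |v N x| ≤ w₀) → w₀ ≤ w₁ →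
      (∀ (k : ℕ), 1 ≤ k → ∀ x' : Tor (fine (L ^ 1 * L ^ k) (kingU d L e)),
          |v (L ^ 1 * L ^ k) x' - v (L ^ k) (underPtN L k 1 (kingU d L e) x')| ≤ ν₀ * s ^ k) →
      ∀ (r : ℝ), 0 < r → r < 1 → ∀ z : ℂ, ‖z‖ < r / (1 + r) * min (cplxWindow d a m2 L / w₀) 1 →
      ∀ (x y : Tor (kingU d L e)) (k : ℕ),
        ‖kingCovPotC d a m2 L (kingM d L e) (k + 1) z (v (L ^ (k + 1))) x y - kingCovLimC a m2 L (kingM d L e) v z x y‖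
          ≤ C ^ (1 - lam r) * (max C (4 / gam0L (d + 1) a L)) ^ lam r * Real.exp (-((1 - lam r) * (κ / 2) * tdistT (kingU d L e) x y))
              * ((((L : ℝ) ^ (-(1 / 4 : ℝ))) ^ (1 - lam r)) ^ (k + 1)) / (1 - ((L : ℝ) ^ (-(1 / 4 : ℝ))) ^ (1 - lam r)) := by
  obtain ⟨κ₁, κ₂, w₁, C, -, hκ₂, hw₁, hC, H⟩ := kingModel_complexCoupling_package (d := d) L hLodd hL ha hm
  refine ⟨κ₂, w₁, C, hκ₂, hw₁, hC, ?_⟩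
  intro e v w₀ ν₀ s hν₀ hν₁ hs0 hs1 hw₀ hv hw₁v hcoh r hr0 hr1 z hz x y k
  exact (H e v w₀ ν₀ s hν₀ hν₁ hs0 hs1 hw₀ hv hw₁v hcoh r hr0 hr1 z hz x y).2.2.2.2.2.2.2.1 k

end KingU

end Summit.QuantumFields.YangMills.BalabanUVNodes.N15.KingModel

end
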